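import Literature.AnabelianGeometry.SemiGraphs.CoherentRayNotGaloisCountable
import Literature.AnabelianGeometry.SemiGraphs.PiPresentationBridgeQuasiCoherent
import Literature.AnabelianGeometry.SemiGraphs.FiniteCoveringsGalois
import Literature.AnabelianGeometry.SemiGraphs.SplittingCriterion
import Literature.AnabelianGeometry.Anabelioids.ComponentsOrbits
import Literature.AnabelianGeometry.Anabelioids.FiberFunctorUnique
import Literature.AnabelianGeometry.Anabelioids.OuterActionOfEquivalence
import Literature.AnabelianGeometry.AbsoluteAnabelian.GaloisSubextensionProofs
import HarnessLib

/-!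
# [SemiAnbd] §2/§3 bridge: coherence and Galois-countability in the two presentations, and
# "strictly" cannot be dropped in [IUTchI] Remark 2.5.3 (i) (T4) — Galois-category form

Mochizuki, *Semi-graphs of anabelioids*, Publ. RIMS **42** (2006), Def. 2.1 pp. 22–23 (semi-graphs
of anabelioids, `B(𝒢)`), Def. 2.3 (iii) p. 25 (coherent), §3 p. 36 (`B^cov(G)`), Def. 3.5 p. 37
(finite étale coverings = finite objects of `B^cov(G)`, "splits")
[cite: MochizukiSemiAnbd2006, Def 2.3(iii) p.25]; Mochizuki, *Inter-universal Teichmüller theory I*,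
Rmk. 2.5.3 (i) (T2)–(T4), kurims manuscript pp. 52–53 [cite: Mochizuki2012, IUTchI Rem. 2.5.3(i)(T4) p.53].

The tree carries two presentations of a semi-graph of anabelioids — the categorical one of §2
(`SemiGraphOfAnabelioids`: Galois categories `𝒢_v`, `𝒢_e`, exact pull-backs `b^*`) and the
profinite-group one of §3 (`ProfiniteSemiGraph`: `Π_v`, `Π_e`, `b_*`), related by
`ProfiniteSemiGraph.toAnab 𝒢 = {B(Π_v), B(Π_e), B(b_*)}` — and the bridge series
`PiPresentationBridge*` (injective type, slimness, elevated, aloof, quasi-coherent, locally open).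
This PROOF-ONLY file (abc-iut cell, layer L3, route T, seat abc-iut-L3-t5; theorems only) adds:

* `BCat.ρ_eq_of_forall_splitsOver` — in `B(Π)`: if `Y` splits over every connected component of `X`
  ([IUTchI] (T2) "splits over the constituent anabelioid associated to each component"), then the
  stabiliser in `Π` of every point of `X` acts trivially on `Y` (the §3 rendering `CovObj.Splits`),
  via the splitting criterion `stabilizer_trivial_of_splitsOver` (`SplittingCriterion`) and the
  identification `Π ≃ₜ* Aut(forget)` (`exists_continuousMulEquiv_aut_forget`);
* `ProfiniteSemiGraph.isCoherent_toAnab` — §3 coherent (of injective type) ⇒ §2 coherent AT EVERY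
  BASEPOINT (`isQuasiCoherent_toAnab` + `Aut F ≃ₜ* Aut(forget) ≃ₜ* Π_v` by
  `nonempty_iso_of_fiberFunctor` / `conjAutContinuous` / `exists_piV_equiv`);
* `ProfiniteSemiGraph.isGaloisCountable_of_toAnab` — **(T2) for `𝒢.toAnab` (§2) ⇒ (T2) for `𝒢`
  (§3)**: an honest countable cofinal family of `B(𝒢.toAnab)` gives, through `ofBObjObj`, a countable
  family of finite objects of `B^cov(𝒢)` with nonempty fibres splitting every finite object; the
  converse `isGaloisCountable_toAnab` (through `toBObjObj`, `BCat.forall_splitsOver_of_ρ_eq`) and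
  **`isGaloisCountable_toAnab_iff`** — (T2) agrees in the two presentations;
* the application: `ProfiniteSemiGraph.CoherentRay.not_isGaloisCountable_toAnab` (the coherent ray
  `𝒢_ray` of `CoherentRayNotGaloisCountable`, read in §2, is connected, countable, coherent and NOT
  Galois-countable) and ★ `SemiGraphOfAnabelioids.not_forall_isCoherent_isGaloisCountable` — the
  statement of the named fact `SemiGraphOfAnabelioids.isGaloisCountable_of_isStrictlyCoherent`
  ([IUTchI] Rmk. 2.5.3 (i) (T4), `Coverticial.lean`, PROVED in the tree) with "strictly coherent"
  weakened to "coherent" is FALSE: the uniform bound of (T3) is necessary.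

Honest framing: bridge lemmas + a tightness datum about OUR typed hypotheses; print's (T4) asserts
the strictly coherent case only, which the tree proves — nothing of print is contradicted.  Outside
the [IUTchIII] Cor. 3.12 cone; nothing here bears on it.
-/

noncomputable section

namespace Literature.AnabelianGeometry.SemiGraphs

open CategoryTheory CategoryTheory.Limits CategoryTheory.PreGaloisCategory
open Literature.AnabelianGeometry.Anabelioids
open Literature.AnabelianGeometry.AbsoluteAnabelian (IsTopologicallyFinitelyGenerated)
open Literature.AlgebraicGeometry.Frobenioids (BCat)
open scoped FintypeCatDiscrete

universe u

/-! ### 1. In `B(Π)`: splitting over all components ⇒ point stabilisers act trivially -/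

section Local

variable {G : Type u} [Group G] [TopologicalSpace G] [IsTopologicalGroup G] [CompactSpace G]
  [T2Space G] [TotallyDisconnectedSpace G]

/-- **(T2)-splitting, §2 ⇒ §3, one constituent.**  In the connected anabelioid `B(Π)` of a
profinite group `Π`: if `Y` splits over every connected component of `X` (`SplitsOver`, [IUTchI]
Rmk. 2.5.3 (i) (T2)), then for every point `x` of `X` every `g ∈ Π` fixing `x` acts trivially on `Y`
([SemiAnbd] Def. 3.5 (ii) "splits", the §3 rendering `CovObj.Splits`).  The component of `x`
(`exists_component_mem_range`) carries a point `p₀` over `x`; `g`, read in `Aut(forget) ≃ Π`, fixes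
`p₀` (the component is a subobject), hence acts trivially on `Y` by `stabilizer_trivial_of_splitsOver`.
[cite: Mochizuki2012, IUTchI Rem. 2.5.3(i)(T2) p.52] -/
theorem BCat.ρ_eq_of_forall_splitsOver (X Y : BCat G)
    (h : letI := galoisCategory_bCat G; ∀ P : π₀Obj X, SplitsOver Y (P.1 : BCat G))
    (x : X.obj.V) (g : G) (hg : (X.obj.ρ g).hom x = x) (y : Y.obj.V) : (Y.obj.ρ g).hom y = y := by
  letI := galoisCategory_bCat G
  let F := ObjectProperty.ι (Action.IsContinuous (V := FintypeCat.{u}) (G := G)) ⋙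
    Action.forget FintypeCat.{u} G
  haveI : FiberFunctor F := fiberFunctor_forget_bCat G
  obtain ⟨e, he⟩ := exists_continuousMulEquiv_aut_forget (G := G)
  obtain ⟨P, p₀, hp₀⟩ := exists_component_mem_range F (X := X) x
  haveI : IsConnected (P.1 : BCat G) := P.2
  have hσ : (e g) • p₀ = p₀ := by
    apply ConcreteCategory.injective_of_mono_of_preservesPullback (F.map P.1.arrow)
    rw [← mulAction_naturality, hp₀, mulAction_def, he]
    exact hg
  have key := stabilizer_trivial_of_splitsOver F (h P) p₀ (e g) hσ y
  rw [mulAction_def, he] at key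
  exact key

omit [CompactSpace G] [T2Space G] [TotallyDisconnectedSpace G] in
/-- An object of `B(Π)` which is not initial has a point (fibre functor `forget`).
[cite: MochizukiGeoAn2004, §1.1 p.9] -/
theorem BCat.nonempty_of_not_isInitial (X : BCat G) (hX : IsInitial X → False) : Nonempty X.obj.V := by
  letI := galoisCategory_bCat G
  haveI : FiberFunctor (ObjectProperty.ι (Action.IsContinuous (V := FintypeCat.{u}) (G := G)) ⋙
      Action.forget FintypeCat.{u} G) := fiberFunctor_forget_bCat G
  exact (not_initial_iff_fiber_nonempty
    (ObjectProperty.ι (Action.IsContinuous (V := FintypeCat.{u}) (G := G)) ⋙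
      Action.forget FintypeCat.{u} G) X).mp hX

omit [CompactSpace G] [T2Space G] [TotallyDisconnectedSpace G] in
/-- An object of `B(Π)` with a point is not initial (fibre functor `forget`).
[cite: MochizukiGeoAn2004, §1.1 p.9] -/
theorem BCat.not_isInitial_of_nonempty (X : BCat G) [hX : Nonempty X.obj.V] : IsInitial X → False := by
  letI := galoisCategory_bCat G
  haveI : FiberFunctor (ObjectProperty.ι (Action.IsContinuous (V := FintypeCat.{u}) (G := G)) ⋙
      Action.forget FintypeCat.{u} G) := fiberFunctor_forget_bCat G
  exact (not_initial_iff_fiber_nonempty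
    (ObjectProperty.ι (Action.IsContinuous (V := FintypeCat.{u}) (G := G)) ⋙
      Action.forget FintypeCat.{u} G) X).mpr hX

/-- **(T2)-splitting, §3 ⇒ §2, one constituent** (converse of `BCat.ρ_eq_of_forall_splitsOver`): if
the stabiliser in `Π` of every point of `X` acts trivially on `Y`, then `Y` splits over every
connected component of `X` (`splitsOver_of_stabilizer`, with `Aut(forget) ≃ Π`).
[cite: Mochizuki2012, IUTchI Rem. 2.5.3(i)(T2) p.52] -/
theorem BCat.forall_splitsOver_of_ρ_eq (X Y : BCat G)
    (h : ∀ (x : X.obj.V) (g : G), (X.obj.ρ g).hom x = x → ∀ y : Y.obj.V, (Y.obj.ρ g).hom y = y) :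
    letI := galoisCategory_bCat G; ∀ P : π₀Obj X, SplitsOver Y (P.1 : BCat G) := by
  letI := galoisCategory_bCat G
  intro P
  let F := ObjectProperty.ι (Action.IsContinuous (V := FintypeCat.{u}) (G := G)) ⋙
    Action.forget FintypeCat.{u} G
  haveI : FiberFunctor F := fiberFunctor_forget_bCat G
  obtain ⟨e, he⟩ := exists_continuousMulEquiv_aut_forget (G := G)
  haveI : IsConnected (P.1 : BCat G) := P.2
  obtain ⟨p₀⟩ := nonempty_fiber_of_isConnected F (P.1 : BCat G)
  refine splitsOver_of_stabilizer F p₀ fun σ hσ y => ?_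
  obtain ⟨g, rfl⟩ := e.surjective σ
  have hx : (X.obj.ρ g).hom (F.map P.1.arrow p₀) = F.map P.1.arrow p₀ := by
    have hn := mulAction_naturality F (e g) P.1.arrow p₀
    rw [hσ, mulAction_def, he] at hn
    exact hn
  have hy := h _ g hx y
  rw [mulAction_def, he]
  exact hy

/-- `Aut F` is topologically finitely generated for EVERY basepoint `F` of `B(Π)` as soon as `Π` is:
`Aut F ≃ₜ* Aut(forget) ≃ₜ* Π` ([SGA1] V 5.7 uniqueness of fibre functors, `nonempty_iso_of_fiberFunctor`;
`exists_continuousMulEquiv_aut_forget`). [cite: MochizukiSemiAnbd2006, Def 2.3(iii) p.25] -/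
theorem BCat.isTopologicallyFinitelyGenerated_aut
    (hG : ∃ S : Finset G, (Subgroup.closure (S : Set G)).topologicalClosure = ⊤)
    (F : BCat G ⥤ FintypeCat.{u}) (hF : letI := galoisCategory_bCat G; FiberFunctor F) :
    IsTopologicallyFinitelyGenerated (Aut F) := by
  letI := galoisCategory_bCat G
  haveI := hF
  haveI : FiberFunctor (ObjectProperty.ι (Action.IsContinuous (V := FintypeCat.{u}) (G := G)) ⋙
      Action.forget FintypeCat.{u} G) := fiberFunctor_forget_bCat G
  obtain ⟨e, -⟩ := exists_continuousMulEquiv_aut_forget (G := G)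
  obtain ⟨κ⟩ := nonempty_iso_of_fiberFunctor
    (ObjectProperty.ι (Action.IsContinuous (V := FintypeCat.{u}) (G := G)) ⋙
      Action.forget FintypeCat.{u} G) F
  exact IsTopologicallyFinitelyGenerated.of_continuousMulEquiv (e.trans (conjAutContinuous κ)) ⟨hG⟩

end Local

/-! ### 2. The bridges `𝒢 → 𝒢.toAnab`: coherence, and (T2) backwards -/

namespace ProfiniteSemiGraph

variable (𝒢 : ProfiniteSemiGraph.{u})

/-- **§3 coherent ⇒ §2 coherent** (for `𝒢` of injective type), at every basepoint of every
constituent: quasi-coherence by `isQuasiCoherent_toAnab`, topological finite generation of the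
`Aut F` by `BCat.isTopologicallyFinitelyGenerated_aut`. [cite: MochizukiSemiAnbd2006, Def 2.3(iii) p.25] -/
theorem isCoherent_toAnab (hinj : 𝒢.IsOfInjectiveType) (h : 𝒢.IsCoherent) : 𝒢.toAnab.IsCoherent := by
  obtain ⟨hqc, hV, hE⟩ := h
  refine ⟨𝒢.isQuasiCoherent_toAnab hinj hqc, fun v F hF => ?_, fun e F hF => ?_⟩
  · -- the basepoint, retyped over `BCat (Π_v)` (same term)
    let Fb : BCat (𝒢.Gv v) ⥤ FintypeCat.{u} := F
    have hFb : (letI := galoisCategory_bCat (𝒢.Gv v); FiberFunctor Fb) := hF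
    exact BCat.isTopologicallyFinitelyGenerated_aut (G := 𝒢.Gv v) (hV v) Fb hFb
  · let Fb : BCat (𝒢.Ge e) ⥤ FintypeCat.{u} := F
    have hFb : (letI := galoisCategory_bCat (𝒢.Ge e); FiberFunctor Fb) := hF
    exact BCat.isTopologicallyFinitelyGenerated_aut (G := 𝒢.Ge e) (hE e) Fb hFb

/-- The covering underlying a finite étale covering (object of `B(𝒢.toAnab)`) is finite.
[cite: MochizukiSemiAnbd2006, Def 3.5(i) p.37] -/
theorem isFinite_ofBObjObj (X : 𝒢.toAnab.BObj) : (𝒢.ofBObjObj X).IsFinite :=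
  ⟨fun v => inferInstanceAs (Finite (X.S v).obj.V), fun e => inferInstanceAs (Finite (X.T e).obj.V)⟩

/-- An honest finite étale covering (non-initial over every constituent) has nonempty fibres.
[cite: Mochizuki2012, IUTchI Rem. 2.5.3(i)(T2) p.52] -/
theorem hasNonemptyFibres_ofBObjObj (X : 𝒢.toAnab.BObj)
    (hV : ∀ v : 𝒢.graph.Vertex, IsInitial (X.S v) → False)
    (hE : ∀ e : 𝒢.graph.Edge, IsInitial (X.T e) → False) : (𝒢.ofBObjObj X).HasNonemptyFibres :=
  ⟨fun v => by
      -- retyped over `BCat (Π_v)` (same term)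
      let Xv : BCat (𝒢.Gv v) := X.S v
      have h : IsInitial Xv → False := hV v
      exact BCat.nonempty_of_not_isInitial Xv h,
    fun e => by
      let Xe : BCat (𝒢.Ge e) := X.T e
      have h : IsInitial Xe → False := hE e
      exact BCat.nonempty_of_not_isInitial Xe h⟩

/-- **(T2), §2 ⇒ §3.**  If the semi-graph of anabelioids `𝒢.toAnab = {B(Π_v), B(Π_e), B(b_*)}` is
Galois-countable in the sense of [IUTchI] Rmk. 2.5.3 (i) (T2) as typed over Galois categories
(`SemiGraphOfAnabelioids.IsGaloisCountable`: an honest countable family of finite étale coverings over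
whose components every finite étale covering splits), then `𝒢` is Galois-countable in the local
presentation (`ProfiniteSemiGraph.IsGaloisCountable`: a countable family of finite objects of
`B^cov(G)` with nonempty fibres splitting every finite object): take the underlying coverings
`ofBObjObj (A i)` and read the splitting constituentwise (`BCat.ρ_eq_of_forall_splitsOver`), the
finite object `H` being read in `B(𝒢.toAnab)` as `toBObjObj H`.
[cite: Mochizuki2012, IUTchI Rem. 2.5.3(i)(T2) p.52] -/
theorem isGaloisCountable_of_toAnab (h : 𝒢.toAnab.IsGaloisCountable) : 𝒢.IsGaloisCountable := by
  obtain ⟨hcnt, A, hAV, hAE, hsplit⟩ := h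
  refine ⟨hcnt, fun i => 𝒢.ofBObjObj (A i),
    fun i => ⟨𝒢.isFinite_ofBObjObj (A i), 𝒢.hasNonemptyFibres_ofBObjObj (A i) (hAV i) (hAE i)⟩,
    fun H hH => ?_⟩
  obtain ⟨i, hV, hE⟩ := hsplit (toBObjObj H hH)
  refine ⟨i, fun v x g hgx s => ?_, fun e x g hgx s => ?_⟩
  · -- the two constituents at `v`, retyped over `BCat (Π_v)` (same terms)
    let X : BCat (𝒢.Gv v) := (A i).S v
    let Y : BCat (𝒢.Gv v) := (toBObjObj H hH).S v
    have hXY : (letI := galoisCategory_bCat (𝒢.Gv v); ∀ P : π₀Obj X, SplitsOver Y (P.1 : BCat (𝒢.Gv v))) :=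
      hV v
    exact BCat.ρ_eq_of_forall_splitsOver (G := 𝒢.Gv v) X Y hXY x g hgx s
  · let X : BCat (𝒢.Ge e) := (A i).T e
    let Y : BCat (𝒢.Ge e) := (toBObjObj H hH).T e
    have hXY : (letI := galoisCategory_bCat (𝒢.Ge e); ∀ P : π₀Obj X, SplitsOver Y (P.1 : BCat (𝒢.Ge e))) :=
      hE e
    exact BCat.ρ_eq_of_forall_splitsOver (G := 𝒢.Ge e) X Y hXY x g hgx s

/-- **(T2), §3 ⇒ §2** (converse of `isGaloisCountable_of_toAnab`): a countable family of finite objects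
of `B^cov(G)` with nonempty fibres splitting every finite object gives, through `toBObjObj`, an honest
countable cofinal family of `B(𝒢.toAnab)` — the finite étale covering `B` being read in `B^cov(G)`
as `ofBObjObj B` and the splitting constituentwise (`BCat.forall_splitsOver_of_ρ_eq`).
[cite: Mochizuki2012, IUTchI Rem. 2.5.3(i)(T2) p.52] -/
theorem isGaloisCountable_toAnab (h : 𝒢.IsGaloisCountable) : 𝒢.toAnab.IsGaloisCountable := by
  obtain ⟨hcnt, F, hF, hsplit⟩ := h
  refine ⟨hcnt, fun i => toBObjObj (F i) (hF i).1, fun i v hI => ?_, fun i e hI => ?_, fun B => ?_⟩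
  · -- retyped over `BCat (Π_v)` (same terms)
    let Xv : BCat (𝒢.Gv v) := (toBObjObj (F i) (hF i).1).S v
    haveI : Nonempty Xv.obj.V := (hF i).2.nonempty_V v
    exact BCat.not_isInitial_of_nonempty Xv (hI : IsInitial Xv)
  · let Xe : BCat (𝒢.Ge e) := (toBObjObj (F i) (hF i).1).T e
    haveI : Nonempty Xe.obj.V := (hF i).2.nonempty_E e
    exact BCat.not_isInitial_of_nonempty Xe (hI : IsInitial Xe)
  · obtain ⟨i, hV, hE⟩ := hsplit (𝒢.ofBObjObj B) (𝒢.isFinite_ofBObjObj B)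
    refine ⟨i, fun v P => ?_, fun e Q => ?_⟩
    · let X : BCat (𝒢.Gv v) := (toBObjObj (F i) (hF i).1).S v
      let Y : BCat (𝒢.Gv v) := B.S v
      have key : (letI := galoisCategory_bCat (𝒢.Gv v);
          ∀ P' : π₀Obj X, SplitsOver Y (P'.1 : BCat (𝒢.Gv v))) :=
        BCat.forall_splitsOver_of_ρ_eq (G := 𝒢.Gv v) X Y (fun x g hgx y => hV v x g hgx y)
      exact key P
    · let X : BCat (𝒢.Ge e) := (toBObjObj (F i) (hF i).1).T e
      let Y : BCat (𝒢.Ge e) := B.T e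
      have key : (letI := galoisCategory_bCat (𝒢.Ge e);
          ∀ Q' : π₀Obj X, SplitsOver Y (Q'.1 : BCat (𝒢.Ge e))) :=
        BCat.forall_splitsOver_of_ρ_eq (G := 𝒢.Ge e) X Y (fun x g hgx y => hE e x g hgx y)
      exact key Q

/-- **(T2) agrees in the two presentations**: `𝒢.toAnab` is Galois-countable (Galois-category form,
`SemiGraphOfAnabelioids.IsGaloisCountable`) iff `𝒢` is (local presentation,
`ProfiniteSemiGraph.IsGaloisCountable`). [cite: Mochizuki2012, IUTchI Rem. 2.5.3(i)(T2) p.52] -/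
theorem isGaloisCountable_toAnab_iff : 𝒢.toAnab.IsGaloisCountable ↔ 𝒢.IsGaloisCountable :=
  ⟨𝒢.isGaloisCountable_of_toAnab, 𝒢.isGaloisCountable_toAnab⟩

/-! ### 3. Application: the coherent ray in the Galois-category presentation -/

namespace CoherentRay

/-- `𝒢_ray` is of injective type (its edge groups are trivial). [cite: MochizukiSemiAnbd2006, Def 2.1 p.22] -/
theorem coherentRay_isOfInjectiveType : coherentRay.IsOfInjectiveType :=
  fun _ _ _ => Function.injective_of_subsingleton _

/-- `𝒢_ray.toAnab = {B((ℤ/2)^{n+1}), B(1), B(1 → (ℤ/2)^{n+1})}` is coherent ([SemiAnbd] Def. 2.3 (iii),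
Galois-category form, every basepoint). [cite: MochizukiSemiAnbd2006, Def 2.3(iii) p.25] -/
theorem isCoherent_toAnab : coherentRay.toAnab.IsCoherent :=
  coherentRay.isCoherent_toAnab coherentRay_isOfInjectiveType coherentRay_isCoherent

/-- `𝒢_ray.toAnab` is connected. [cite: MochizukiSemiAnbd2006, Def. 2.1 p.22] -/
theorem isConnected_toAnab : coherentRay.toAnab.IsConnected := ⟨coherentRay_isConnected⟩

/-- `𝒢_ray.toAnab` is NOT Galois-countable ([IUTchI] Rmk. 2.5.3 (i) (T2), Galois-category form):
by `isGaloisCountable_of_toAnab` and `coherentRay_not_isGaloisCountable`.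
[cite: Mochizuki2012, IUTchI Rem. 2.5.3(i)(T2) p.52] -/
theorem not_isGaloisCountable_toAnab : ¬ coherentRay.toAnab.IsGaloisCountable := fun h =>
  coherentRay_not_isGaloisCountable (coherentRay.isGaloisCountable_of_toAnab h)

end CoherentRay

end ProfiniteSemiGraph

/-- **"Strictly" cannot be dropped in [IUTchI] Rmk. 2.5.3 (i) (T4), Galois-category form.**  The
statement of the named fact `SemiGraphOfAnabelioids.isGaloisCountable_of_isStrictlyCoherent`
(`Coverticial.lean`: `∀ 𝒢, 𝒢.IsConnected → 𝒢.IsStrictlyCoherent → 𝒢.graph.IsCountable →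
𝒢.IsGaloisCountable`, PROVED in the tree) with `IsStrictlyCoherent` weakened to `IsCoherent` is FALSE,
at the coherent ray `𝒢_ray.toAnab` (vertex anabelioids `B((ℤ/2)^{n+1})`, `n ∈ ℕ`).  A tightness
datum about the typed hypothesis; print's (T4) asserts the strictly coherent case only.
[cite: Mochizuki2012, IUTchI Rem. 2.5.3(i)(T4) p.53] -/
theorem SemiGraphOfAnabelioids.not_forall_isCoherent_isGaloisCountable :
    ¬ ∀ (𝒢 : SemiGraphOfAnabelioids.{0, 1, 0}), 𝒢.IsConnected → 𝒢.IsCoherent →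
        𝒢.graph.IsCountable → 𝒢.IsGaloisCountable := fun h =>
  ProfiniteSemiGraph.CoherentRay.not_isGaloisCountable_toAnab
    (h _ ProfiniteSemiGraph.CoherentRay.isConnected_toAnab
      ProfiniteSemiGraph.CoherentRay.isCoherent_toAnab
      ProfiniteSemiGraph.CoherentRay.coherentRay_isCountable)

/-- The countermodel, packaged in the Galois-category presentation: a connected, countable, coherent
semi-graph of anabelioids which is not Galois-countable. [cite: Mochizuki2012, IUTchI Rem. 2.5.3(i)(T4) p.53] -/
theorem SemiGraphOfAnabelioids.exists_isCoherent_not_isGaloisCountable :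
    ∃ 𝒢 : SemiGraphOfAnabelioids.{0, 1, 0}, 𝒢.IsConnected ∧ 𝒢.IsCoherent ∧ 𝒢.graph.IsCountable ∧
      ¬ 𝒢.IsGaloisCountable :=
  ⟨_, ProfiniteSemiGraph.CoherentRay.isConnected_toAnab, ProfiniteSemiGraph.CoherentRay.isCoherent_toAnab,
    ProfiniteSemiGraph.CoherentRay.coherentRay_isCountable,
    ProfiniteSemiGraph.CoherentRay.not_isGaloisCountable_toAnab⟩

end Literature.AnabelianGeometry.SemiGraphs
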